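import Summits.BirchSwinnertonDyer.BirchSwinnertonDyer.Theorems.QuadraticBranchSignedControlGss2Pairs
import HarnessLib

/-!
# Route `QuadraticBranchSignedControl` (rung K8, cell `bsd-potss`): the load-bearing support
# `Gss2Assembly` (item stmt-BirchSwinnertonDyer-19119) — PROVED

After the route's tenure re-typed `PublishedInputsGss2` (rev 1, 2026-08-25T23:57Z) to carry the sixth
published input `ModularForms.mazur_not_dvd_maninConstant_of_odd` (Mazur, Invent. Math. 44 (1978)
Cor. 4.1: the Manin constant is prime to an odd `p` with `p² ∤ N` — the `p`-INTEGRALITY of the period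
ratio `Ω_f^±/Ω_V^±` of the good supersingular twin, without which the branch functions `L_p^±(V, η, X) ∈
ℤ_p⟦X⟧` quantified by (C1_η)/(MC±_η) need not exist; seat ctrl g3's finding), the item
`Gss2Assembly := PublishedInputsGss2 → PlusMainConjectureBranch → EtaTransportSigned →
NoFiniteSubmoduleSigned → PAdicGrossZagierBranch → ∀ W p, r_an(W) ≤ 1 → 5 ≤ p → Addv W p → SubGss W p →
MissingPPartAt W p` is the sibling pair theorem `missingPPartAt_of_signedControlCruxes_of_mazur`
(`Theorems/QuadraticBranchSignedControlGss2Pairs.lean`) fed with the six published inputs and the four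
cruxes: the twin `V` is produced, rank `0` runs through the cell's EXACT even control from (MC⁺_η) +
(R2⁺) + Poitou–Tate and the value identity, rank `1` through x1b's odd-branch chain with the exact odd
control from (MC⁻_η) + (R2⁻) + Poitou–Tate and C-cc-1. Nothing about the cruxes is asserted (they are
the hypotheses of the support); no pair's `BSD(W, p)` is claimed; nothing booked. Seat `bsd-potss-ctrl`
generation 3.
-/

set_option autoImplicit false
set_option linter.dupNamespace false

noncomputable section

namespace Summit.BirchSwinnertonDyer.BirchSwinnertonDyer.Theorems

/-- **The K8 support `Gss2Assembly`, proved** (route `QuadraticBranchSignedControl`, item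
stmt-BirchSwinnertonDyer-19119): the six published inputs (GZK, modularity ×2, Gross–Zagier I.(7.3),
Poitou–Tate, Mazur's `p ∤ c₀`) and the four cruxes give `ord_p #Ш(W) = ord_p #Ш_an(W)` on every Gss2
pair of analytic rank `≤ 1`, `p ≥ 5`, by `missingPPartAt_of_signedControlCruxes_of_mazur`.
[cite: Mazur1978, Cor. 4.1] [cite: Kobayashi2003, Thm. 3.2 (p. 7), §4 (p. 8), Thm. 7.4 (p. 13), Thm. 9.3 (p. 26)]
[cite: KitajimaOtsuki2018, Main Thm. 1.3] [cite: MilneADT2006, I Thm. 4.10] [cite: Miller2011LMS, §1 and Def. 1.1] -/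
theorem gss2Assembly_proof :
    Summit.BirchSwinnertonDyer.BirchSwinnertonDyer.Theses.QuadraticBranchSignedControl.Gss2Assembly := by
  intro hP h₁ h₂ h₃ h₄ W _ _ p _ hr hp5 hadd hGss
  obtain ⟨hGZK, hmod, hnf, hGZ, hPT, hM⟩ := hP
  exact missingPPartAt_of_signedControlCruxes_of_mazur hGZK hmod hnf hGZ hPT hM h₁ h₂ h₃ h₄ W p hr
    hp5 hadd hGss

end Summit.BirchSwinnertonDyer.BirchSwinnertonDyer.Theorems

end
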